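import Summits.KontsevichZagierPeriods.KontsevichZagierPeriods.Theorems.RootDecompRationalCubeDichotomyMonomialDivisionP0

/-! # `RootDecompRationalCubeDichotomyMonomialDivisionP1` — part 2/2 of the mechanical ≤260-line split of `RootDecompRationalCubeDichotomyMonomialDivisionP1.lean`
(split by the decomp-kz census seat for landing; mathematics unchanged; part 2 continues part 1). -/

noncomputable section
set_option linter.dupNamespace false
set_option linter.unusedVariables false
set_option linter.unusedSectionVars false

namespace Summit.KontsevichZagierPeriods.RootDecompRationalCubeDichotomy.Rung24903.MonomialDivision
open MvPolynomial Filter Topology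
open Summit.KontsevichZagierPeriods.RootDecompRationalCubeDichotomy.Rung29430.MultiGen
  (MultiGenData multiGenData_of_pointData ratBox isOpen_ratBox isSemialgebraic_ratBox exists_ratBox_subset)
open Summit.KontsevichZagierPeriods.RootDecompRationalCubeDichotomy.Rung29430.MultiGen.NashImplicit
  (solutions_eq_near)

section Concrete
variable {n k : ℕ}

/-- `δ ∘ rename e₂ = id`. -/
theorem aeval_dmap_rename_e₂ (p : MvPolynomial (Fin (n + k)) ℚ) :
    MvPolynomial.aeval (dmap n k) (rename (e₂ n k) p) = p := by
  rw [MvPolynomial.aeval_rename]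
  have : (dmap n k) ∘ (e₂ n k) = X := by
    funext r
    induction r using Fin.addCases with
    | left i => simp
    | right j => simp
  rw [this, MvPolynomial.aeval_X_left_apply]

/-- **Diagonal values of divided differences are partial derivatives.** -/
theorem diag_eq_pderiv (p : MvPolynomial (Fin (n + k)) ℚ) (Φ : Fin k → MvPolynomial (Fin (n + (k + k))) ℚ)
    (h : rename (e₁ n k) p - rename (e₂ n k) p = ∑ l, Φ l * (X (Y n k l) - X (Y' n k l))) (j : Fin k) :
    MvPolynomial.aeval (dmap n k) (Φ j) = pderiv (Fin.natAdd n j) p := by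
  classical
  have h1 : pderiv (Y n k j) (rename (e₁ n k) p) = rename (e₁ n k) (pderiv (Fin.natAdd n j) p) :=
    pderiv_rename_of_iff _ _ _ (fun r => e₁_eq_Y_iff r j) p
  have h2 : pderiv (Y n k j) (rename (e₂ n k) p) = 0 :=
    pderiv_rename_of_ne _ _ (fun r => e₂_ne_Y r j) p
  have h3 := congrArg (fun q => MvPolynomial.aeval (dmap n k) (pderiv (Y n k j) q)) h
  simp only [map_sub, map_sum, pderiv_mul, map_add, map_mul] at h3
  rw [h1, h2, map_zero, sub_zero, aeval_dmap_rename_e₁] at h3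
  rw [h3]
  have hterm : ∀ l, MvPolynomial.aeval (dmap n k) (pderiv (Y n k j) (Φ l)) *
      (MvPolynomial.aeval (dmap n k) (X (Y n k l) : MvPolynomial (Fin (n + (k + k))) ℚ) -
        MvPolynomial.aeval (dmap n k) (X (Y' n k l) : MvPolynomial (Fin (n + (k + k))) ℚ)) +
      MvPolynomial.aeval (dmap n k) (Φ l) *
      (MvPolynomial.aeval (dmap n k) (pderiv (Y n k j) (X (Y n k l) : MvPolynomial (Fin (n + (k + k))) ℚ)) -
        MvPolynomial.aeval (dmap n k)
          (pderiv (Y n k j) (X (Y' n k l) : MvPolynomial (Fin (n + (k + k))) ℚ))) =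
      if l = j then MvPolynomial.aeval (dmap n k) (Φ l) else 0 := by
    intro l
    rw [MvPolynomial.aeval_X, MvPolynomial.aeval_X, dmap_Y, dmap_Y', sub_self, mul_zero, zero_add,
      pderiv_X_of_ne (Y_ne_Y' j l).symm, map_zero, sub_zero]
    by_cases hl : l = j
    · subst hl; rw [pderiv_X_self, map_one, mul_one, if_pos rfl]
    · rw [pderiv_X_of_ne (fun h => hl (Y_injective h)), map_zero, mul_zero, if_neg hl]
  rw [Finset.sum_congr rfl fun l _ => hterm l, Finset.sum_ite_eq' Finset.univ j, if_pos (Finset.mem_univ j)]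

/-! #### Evaluation bookkeeping -/

/-- evaluation point `(x, w, w')`. -/
def pt3 (x : Fin n → ℝ) (w w' : Fin k → ℝ) : Fin (n + (k + k)) → ℝ := Fin.append x (Fin.append w w')

/-- Auxiliary step `aeval_pt3_rename_e₁`. [bookkeeping] -/
theorem aeval_pt3_rename_e₁ (x : Fin n → ℝ) (w w' : Fin k → ℝ) (p : MvPolynomial (Fin (n + k)) ℚ) :
    MvPolynomial.aeval (pt3 x w w') (rename (e₁ n k) p) = MvPolynomial.aeval (Fin.append x w) p := by
  rw [MvPolynomial.aeval_rename]
  have : pt3 x w w' ∘ e₁ n k = Fin.append x w := by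
    funext r
    induction r using Fin.addCases with
    | left i => simp only [Function.comp_apply, e₁_left, pt3, Fin.append_left]
    | right j => simp only [Function.comp_apply, e₁_right, Y, pt3, Fin.append_right, Fin.append_left]
  rw [this]

/-- Auxiliary step `aeval_pt3_rename_e₂`. [bookkeeping] -/
theorem aeval_pt3_rename_e₂ (x : Fin n → ℝ) (w w' : Fin k → ℝ) (p : MvPolynomial (Fin (n + k)) ℚ) :
    MvPolynomial.aeval (pt3 x w w') (rename (e₂ n k) p) = MvPolynomial.aeval (Fin.append x w') p := by
  rw [MvPolynomial.aeval_rename]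
  have : pt3 x w w' ∘ e₂ n k = Fin.append x w' := by
    funext r
    induction r using Fin.addCases with
    | left i => simp only [Function.comp_apply, e₂_left, pt3, Fin.append_left]
    | right j => simp only [Function.comp_apply, e₂_right, Y', pt3, Fin.append_right]
  rw [this]

/-- Auxiliary step `pt3_Y`. [bookkeeping] -/
@[simp] theorem pt3_Y (x : Fin n → ℝ) (w w' : Fin k → ℝ) (j : Fin k) : pt3 x w w' (Y n k j) = w j := by
  simp only [pt3, Y, Fin.append_right, Fin.append_left]
/-- Auxiliary step `pt3_Y'`. [bookkeeping] -/
@[simp] theorem pt3_Y' (x : Fin n → ℝ) (w w' : Fin k → ℝ) (j : Fin k) : pt3 x w w' (Y' n k j) = w' j := by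
  simp only [pt3, Y', Fin.append_right]
/-- Auxiliary step `pt3_left`. [bookkeeping] -/
@[simp] theorem pt3_left (x : Fin n → ℝ) (w w' : Fin k → ℝ) (i : Fin n) :
    pt3 x w w' (Fin.castAdd (k + k) i) = x i := by
  simp only [pt3, Fin.append_left]

/-- evaluating the diagonal substitution = evaluating at a diagonal point. -/
theorem aeval_aeval_dmap (x : Fin n → ℝ) (w : Fin k → ℝ) (P : MvPolynomial (Fin (n + (k + k))) ℚ) :
    MvPolynomial.aeval (Fin.append x w) (MvPolynomial.aeval (dmap n k) P) =
      MvPolynomial.aeval (pt3 x w w) P := by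
  rw [MvPolynomial.comp_aeval_apply]
  have : (fun t => MvPolynomial.aeval (Fin.append x w) (dmap n k t)) = pt3 x w w := by
    funext t
    induction t using Fin.addCases with
    | left i => rw [dmap_left, MvPolynomial.aeval_X, Fin.append_left, pt3_left]
    | right j' =>
      induction j' using Fin.addCases with
      | left j =>
        rw [show Fin.natAdd n (Fin.castAdd k j) = Y n k j from rfl, dmap_Y, MvPolynomial.aeval_X,
          Fin.append_right, pt3_Y]
      | right j =>
        rw [show Fin.natAdd n (Fin.natAdd k j) = Y' n k j from rfl, dmap_Y', MvPolynomial.aeval_X,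
          Fin.append_right, pt3_Y']
  rw [this]

/-- the substitution `x_i := c`. -/
def substMap (n k : ℕ) (i : Fin n) (c : ℚ) : Fin (n + k) → MvPolynomial (Fin (n + k)) ℚ :=
  fun r => if r = Fin.castAdd k i then C c else X r

/-- evaluating `p[x_i := c]` at `(x, w)` = evaluating `p` at `(x|_{x_i := c}, w)`. -/
theorem aeval_subst (i : Fin n) (c : ℚ) (x : Fin n → ℝ) (w : Fin k → ℝ) (p : MvPolynomial (Fin (n + k)) ℚ) :
    MvPolynomial.aeval (Fin.append x w) (MvPolynomial.aeval (substMap n k i c) p) =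
      MvPolynomial.aeval (Fin.append (Function.update x i (c : ℝ)) w) p := by
  rw [MvPolynomial.comp_aeval_apply]
  have : (fun r => MvPolynomial.aeval (Fin.append x w) (substMap n k i c r)) =
      Fin.append (Function.update x i (c : ℝ)) w := by
    funext r
    induction r using Fin.addCases with
    | left i' =>
      by_cases h : i' = i
      · subst h
        simp [substMap]
      · have hne : Fin.castAdd k i' ≠ Fin.castAdd k i := fun h' => h (Fin.castAdd_injective _ _ h')
        simp [substMap, hne, Function.update_of_ne h]
    | right j =>
      have hne : Fin.natAdd n j ≠ Fin.castAdd k i := by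
        simp only [ne_eq, Fin.ext_iff, Fin.val_castAdd, Fin.val_natAdd]; all_goals omega
      simp [substMap, hne]
  rw [this]

/-- Auxiliary step `pderiv_subst`. [bookkeeping] -/
theorem pderiv_subst (i : Fin n) (c : ℚ) (j : Fin k) (p : MvPolynomial (Fin (n + k)) ℚ) :
    pderiv (Fin.natAdd n j) (MvPolynomial.aeval (substMap n k i c) p) =
      MvPolynomial.aeval (substMap n k i c) (pderiv (Fin.natAdd n j) p) := by
  have hne : Fin.natAdd n j ≠ Fin.castAdd k i := by
    simp only [ne_eq, Fin.ext_iff, Fin.val_castAdd, Fin.val_natAdd]; all_goals omega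
  refine pderiv_aeval_of_fix _ _ (by simp [substMap, hne]) (fun r hr => ?_) p
  by_cases h : r = Fin.castAdd k i
  · simp [substMap, h]
  · simp [substMap, h, pderiv_X_of_ne hr]

end Concrete

/-! ### §C  Continuity bookkeeping -/

section Cont

variable {n k : ℕ}

/-- Auxiliary step `continuous_aeval_real`. [bookkeeping] -/
theorem continuous_aeval_real {τ : Type*} (P : MvPolynomial τ ℚ) :
    Continuous fun z : τ → ℝ => MvPolynomial.aeval z P := by
  have : (fun z : τ → ℝ => MvPolynomial.aeval z P) =
      fun z => MvPolynomial.eval z (MvPolynomial.map (algebraMap ℚ ℝ) P) := by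
    funext z; rw [MvPolynomial.eval_map, MvPolynomial.aeval_def]
  rw [this]; exact MvPolynomial.continuous_eval _

/-- Auxiliary step `append_eq_pt3`. [bookkeeping] -/
theorem append_eq_pt3 (x : Fin n → ℝ) (vv : Fin (k + k) → ℝ) :
    Fin.append x vv = pt3 x (fun j => vv (Fin.castAdd k j)) (fun j => vv (Fin.natAdd k j)) := by
  funext t
  induction t using Fin.addCases with
  | left i => simp only [pt3, Fin.append_left]
  | right j' =>
    simp only [pt3, Fin.append_right]
    induction j' using Fin.addCases with
    | left j => simp only [Fin.append_left]
    | right j => simp only [Fin.append_right]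

/-- continuity of `x ↦ (x, w x, w' x)` on a set where the `w, w'` are continuous. -/
theorem continuousOn_pt3 {O : Set (Fin n → ℝ)} {w w' : Fin k → (Fin n → ℝ) → ℝ}
    (hw : ∀ j, ContinuousOn (w j) O) (hw' : ∀ j, ContinuousOn (w' j) O) :
    ContinuousOn (fun x => pt3 x (fun j => w j x) (fun j => w' j x)) O := by
  refine continuousOn_pi.2 fun t => ?_
  induction t using Fin.addCases with
  | left i =>
    simp only [pt3_left]
    exact (continuous_apply i).continuousOn
  | right j' =>
    induction j' using Fin.addCases with
    | left j =>
      have : (fun x => pt3 x (fun j => w j x) (fun j => w' j x) (Fin.natAdd n (Fin.castAdd k j))) = w j := by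
        funext x; exact pt3_Y x _ _ j
      rw [this]; exact hw j
    | right j =>
      have : (fun x => pt3 x (fun j => w j x) (fun j => w' j x) (Fin.natAdd n (Fin.natAdd k j))) = w' j := by
        funext x; exact pt3_Y' x _ _ j
      rw [this]; exact hw' j

end Cont

/-! ### §D  The theorem -/

end Summit.KontsevichZagierPeriods.RootDecompRationalCubeDichotomy.Rung24903.MonomialDivision

end

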